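import Summits.CriticalPhenomena.SAWScalingLimit.Theorems.LeftRightFKG.Negative.PAKitMain
import Summits.CriticalPhenomena.SAWScalingLimit.Theorems.LeftRightFKG.Negative.InstancePA
import Summits.CriticalPhenomena.SAWScalingLimit.Theorems.LeftRightFKG.Negative.CornerCertWeight4
import Summits.CriticalPhenomena.SAWScalingLimit.Theorems.LeftRightFKG.Negative.CornerCertBoxes
import HarnessLib

/-!
# Negative knowledge on crux `LeftRightFKG`, part 18: FULL left–right positive association of the `4 × 4` crux
instance, certified (`PAKit`, parts 13–17)

Crux `stmt-CriticalPhenomena-11232` (`Summit.CriticalPhenomena.SAWScalingLimit.Theses.SAWLeftRightFKG.LeftRightFKG`).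
The instance of part 8 (`CornerCertWeight4`): `δ = 1`, `C = C₄` = boundary walk of `[-1,4]²`, `Ω = dom C₄ 1`
(= `Ω₄`, lattice sites `{0..3}²`), `a = (0,0)`, `b = (3,3)`, `a' = (0,-1)`, `b' = (3,4)`; 184 chords.

* `checkAll_box4` — THE CERTIFICATE: the checker accepts the certified code enumeration on the window
  `[1/3, 1/2]` (1781 non-trivial prefix/suffix classes, 1211 `2 × 2` minors, 288 of them identically zero, the rest
  positive by validated dyadic interval arithmetic at scale `2^128`, bisection depth `6`); `native_decide`, ≈ 20 s —
  COMPUTATIONAL grade (trusts the Lean compiler), like part 10;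
* `cornerBlock_box4` — the corner blocks `hC` of the instance at every `x ∈ [1/3, 1/2]` (part 17);
* **`pa_box4`** — for every `x ∈ [1/3, 1/2]` and ALL `≼`-up-closed `A`, `B`: `μ(A) μ(B) ≤ μ(univ) μ(A ∩ B)`;
* **`weight_pa_box4`** — THE CONCLUSION OF `LeftRightFKG` FOR THIS INSTANCE: `w(A) w(B) ≤ w(univ) w(A ∩ B)` for all
  `≼`-up-closed `A`, `B`, `w = SAW.weight` (`x_c ∈ [1/3, 1/2]` by `criticalFugacity_mem_elemWindow`).

Part 8 certified ONE pair of corner events of this instance; this is the full statement (all pairs of up-sets).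
Elementary ("folklore") modulo the compiled evaluation.
-/

namespace Summit.CriticalPhenomena.SAWScalingLimit.Theorems.LeftRightFKG.Negative.PAKit

open Literature.Analysis.ValidatedNumerics
open PolyMP (evalR addR mulR smulR posOn)
open PolyCert (realOf minorI)
open Census (censusList census)

/-! ## §9 Instance: the `4 × 4` box `{0..3}²`, `(0,0) → (3,3)` — FULL positive association on `[1/3, 1/2]` -/

section Inst4

open Finset
open Literature.Probability.LatticeModels Literature.Probability.RandomPlanarGeometry
open CornerLoc (cls restrP IsUpOn NextDet PrevDet IsUp IsInst dom μx)
open CornerCert (C₄ inV₄ dAdj₄_iff isInstance₄ length_le₄ nodup_L₄ criticalFugacity_mem_elemWindow)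
open scoped Classical

/-- **THE CERTIFICATE** (compiled evaluation, ≈ 20 s): the checker accepts the 184 chord codes of the `4 × 4` box
with the configuration `b = (3,3)`, crossing box `[0,3]²`, length bound `15`, dyadic scale `2^128`, bisection depth
`6`, window `[1/3, 1/2]`. [folklore] -/
theorem checkAll_box4 :
    checkAll ⟨(3, 3), 0, 3, 0, 3, 15, 2 ^ 128, 6, 1 / 3, 1 / 2⟩ (codes inV₄ 15 (toZ2 (bx 0 0)) (toZ2 (bx 3 3))) = true := by
  native_decide

/-- The corner blocks of the `4 × 4` crux instance `(C₄, 1, (0,0), (3,3))` on the window `[1/3, 1/2]`. [folklore] -/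
theorem cornerBlock_box4 {x : ℝ} (hlo : ((1 / 3 : ℚ) : ℝ) ≤ x) (hhi : x ≤ ((1 / 2 : ℚ) : ℝ))
    [Fintype (SAW.DomainSAW (dom C₄ 1) 1 (bx 0 0) (bx 3 3))] :
    ∀ (k : ℕ) (π : ℕ → Site 2) (m : ℕ) (σ : ℕ → Site 2) (Sa Sb : Set (Site 2))
      (A B : Set (SAW.DomainSAW (dom C₄ 1) 1 (bx 0 0) (bx 3 3))) (s : Finset (SAW.DomainSAW (dom C₄ 1) 1 (bx 0 0) (bx 3 3))),
      s = univ.filter (· ∈ restrP k π m σ Sa Sb) → IsUpOn (cls k π m σ) A →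
      IsUpOn (cls k π m σ) B → NextDet k A → PrevDet m B →
      (∑ γ ∈ s.filter (· ∈ A), x ^ γ.length) * (∑ γ ∈ s.filter (· ∈ B), x ^ γ.length) ≤
        (∑ γ ∈ s, x ^ γ.length) * ∑ γ ∈ (s.filter (· ∈ A)).filter (· ∈ B), x ^ γ.length :=
  cornerBlock_of_checkAll (Ω := dom C₄ 1) (g := ⟨(3, 3), 0, 3, 0, 3, 15, 2 ^ 128, 6, 1 / 3, 1 / 2⟩)
    (fun x y => dAdj₄_iff x y) rfl (fun γ => length_le₄ γ) (by decide)
    (fun p hp => by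
      simp only [inV₄, Bool.and_eq_true, decide_eq_true_eq] at hp
      exact ⟨⟨hp.1.1.1, hp.1.1.2⟩, hp.1.2, hp.2⟩)
    nodup_L₄ checkAll_box4 (by decide) (by norm_num) (by norm_num) hlo hhi

/-- **FULL LEFT–RIGHT POSITIVE ASSOCIATION of the `4 × 4` crux instance, kernel/compiler-certified on the whole
window `[1/3, 1/2] ∋ x_c`**: for every fugacity `x` of the window and ALL `≼`-up-closed `A`, `B`,
`μ(A) μ(B) ≤ μ(univ) μ(A ∩ B)`. [folklore] -/
theorem pa_box4 {x : ℝ} (hlo : ((1 / 3 : ℚ) : ℝ) ≤ x) (hhi : x ≤ ((1 / 2 : ℚ) : ℝ))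
    (A B : Set (SAW.DomainSAW (dom C₄ 1) 1 (bx 0 0) (bx 3 3))) (hA : IsUp A) (hB : IsUp B) :
    μx x (dom C₄ 1) 1 (bx 0 0) (bx 3 3) A * μx x (dom C₄ 1) 1 (bx 0 0) (bx 3 3) B ≤
      μx x (dom C₄ 1) 1 (bx 0 0) (bx 3 3) Set.univ * μx x (dom C₄ 1) 1 (bx 0 0) (bx 3 3) (A ∩ B) := by
  haveI := CornerLoc.finite_domainSAW (a := bx 0 0) (b := bx 3 3) C₄ one_pos
  haveI : Fintype (SAW.DomainSAW (dom C₄ 1) 1 (bx 0 0) (bx 3 3)) := Fintype.ofFinite _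
  have hx : 0 < x := lt_of_lt_of_le (by norm_num) hlo
  exact CornerLoc.pa_inst_of_cornerBlock hx isInstance₄ (cornerBlock_box4 hlo hhi) A B hA hB

/-- **The conclusion of `LeftRightFKG` for the `4 × 4` instance** (`δ = 1`, `C = C₄`, `a = (0,0)`, `b = (3,3)`,
`a' = (0,-1)`, `b' = (3,4)`): `w(A) w(B) ≤ w(univ) w(A ∩ B)` for ALL `≼`-up-closed `A`, `B` (`w = SAW.weight` at
`x_c ∈ [1/3, 1/2]`). [folklore] -/
theorem weight_pa_box4 (A B : Set (SAW.DomainSAW (dom C₄ 1) 1 (bx 0 0) (bx 3 3))) (hA : IsUp A) (hB : IsUp B) :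
    SAW.weight (dom C₄ 1) 1 (bx 0 0) (bx 3 3) A * SAW.weight (dom C₄ 1) 1 (bx 0 0) (bx 3 3) B ≤
      SAW.weight (dom C₄ 1) 1 (bx 0 0) (bx 3 3) Set.univ * SAW.weight (dom C₄ 1) 1 (bx 0 0) (bx 3 3) (A ∩ B) := by
  haveI := CornerLoc.finite_domainSAW (a := bx 0 0) (b := bx 3 3) C₄ one_pos
  haveI : Fintype (SAW.DomainSAW (dom C₄ 1) 1 (bx 0 0) (bx 3 3)) := Fintype.ofFinite _
  exact CornerLoc.weight_pa_inst_of_cornerBlock isInstance₄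
    (cornerBlock_box4 criticalFugacity_mem_elemWindow.1 criticalFugacity_mem_elemWindow.2) A B hA hB

end Inst4

end Summit.CriticalPhenomena.SAWScalingLimit.Theorems.LeftRightFKG.Negative.PAKit
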